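import Literature.NumberTheory.DiophantineGeometry.MinimalDiscriminant
import HarnessLib

/-!
# The minimal discriminant of a Weierstrass curve — discharged facts

Proofs of named facts stated in `Literature.NumberTheory.DiophantineGeometry.MinimalDiscriminant`
(kept in a sibling file so that the statement file stays a definitions/named-facts file).

* `WeierstrassCurve.minimalDiscriminantIdeal_ne_bot_holds` discharges
  `WeierstrassCurve.minimalDiscriminantIdeal_ne_bot`: the minimal discriminant ideal
  `𝔇_min = ∏ᶠ_v 𝔭_v ^ ord_v (Δ_min)` of a Weierstrass curve over the fraction field of a Dedekind
  domain `A` is nonzero.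
* `WeierstrassCurve.minimalDiscriminantNorm_pos_holds` discharges
  `WeierstrassCurve.minimalDiscriminantNorm_pos`: over `ℤ ⊆ ℚ` the minimal discriminant norm
  `N 𝔇_min = |Δ_min|` is positive.
* `WeierstrassCurve.ordMinimalDiscriminant_eq_zero_iff_holds` discharges
  `WeierstrassCurve.ordMinimalDiscriminant_eq_zero_iff`: for an elliptic `W`, `ord_v (Δ_min) = 0`
  iff `W` has good reduction at `v` (Silverman, AEC VII.5, Prop. 5.1(a), p. 174).

## References

* J. H. Silverman, *The Arithmetic of Elliptic Curves*, GTM 106, 2nd ed. 2009, §VIII.8, p. 243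
  (Definition of the minimal discriminant `𝒟_{E/K} = ∏_v 𝔭_v ^ v(Δ_v)`, an integral ideal of `K`);
  §VII.5, Prop. 5.1(a), p. 174 ("`E` has good reduction if and only if `v(Δ) = 0`, i.e.
  `Δ ∈ R^*`", for a minimal Weierstrass equation).
-/

open IsDedekindDomain


namespace WeierstrassCurve

variable (A : Type*) [CommRing A] [IsDedekindDomain A] {K : Type*} [Field K]
  [Algebra A K] [IsFractionRing A K] (W : WeierstrassCurve K)

/-- Discharge of `WeierstrassCurve.minimalDiscriminantIdeal_ne_bot`: `𝔇_min ≠ 0`.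
Silverman, AEC VIII.8, p. 243 (Definition: `𝒟_{E/K} = ∏_v 𝔭_v ^ v(Δ_v)` is an integral ideal, a
finite product of powers of nonzero primes, hence nonzero). Proof: `finprod_induction` on the
predicate `· ≠ ⊥` with `⊤ ≠ ⊥` (a Dedekind domain is nontrivial), `I ≠ ⊥ → J ≠ ⊥ → I * J ≠ ⊥`
(`Ideal.mul_eq_bot`, `A` a domain) and `𝔭_v ^ n ≠ ⊥` (`HeightOneSpectrum.ne_bot`). No ellipticity
hypothesis is needed: on infinite support `finprod` is the junk value `1 = ⊤ ≠ ⊥`.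
(Dot-notation extension of the Mathlib namespace `WeierstrassCurve`.)
[cite: SilvermanAEC2009, VIII.8] -/
theorem minimalDiscriminantIdeal_ne_bot_holds : minimalDiscriminantIdeal_ne_bot A W := by
  unfold minimalDiscriminantIdeal_ne_bot minimalDiscriminantIdeal
  refine finprod_induction (fun I : Ideal A => I ≠ ⊥) ?_ ?_ ?_
  · simpa only [Ideal.one_eq_top] using top_ne_bot
  · intro I J hI hJ
    simpa only [ne_eq, Ideal.mul_eq_bot, not_or] using And.intro hI hJ
  · intro v
    exact pow_ne_zero _ v.ne_bot

/-- Discharge of `WeierstrassCurve.minimalDiscriminantNorm_pos`: over `ℤ ⊆ ℚ`,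
`0 < N 𝔇_min = |Δ_min|`. Silverman, AEC VIII.8, p. 243 (Definition: `𝒟_{E/K}` is a nonzero
integral ideal, so its absolute norm is a positive integer). Proof: `𝔇_min ≠ ⊥`
(`minimalDiscriminantIdeal_ne_bot_holds`) and `Ideal.absNorm I = 0 ↔ I = ⊥`
(`Ideal.absNorm_eq_zero_iff`). No ellipticity hypothesis is needed (junk value `1` for `Δ = 0`).
(Dot-notation extension of the Mathlib namespace `WeierstrassCurve`.)
[cite: SilvermanAEC2009, VIII.8] -/
theorem minimalDiscriminantNorm_pos_holds (W : WeierstrassCurve ℚ) :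
    minimalDiscriminantNorm_pos W := by
  unfold minimalDiscriminantNorm_pos minimalDiscriminantNorm
  exact Nat.pos_of_ne_zero fun h =>
    minimalDiscriminantIdeal_ne_bot_holds ℤ W (Ideal.absNorm_eq_zero_iff.mp h)

section Local

variable {A}

/-- Discharge of the named fact `WeierstrassCurve.ordMinimalDiscriminant_eq_zero_iff`: for an
elliptic `W`, `ord_v (Δ_min) = 0` iff `W` has good reduction at `v`. Silverman, AEC VII.5,
Prop. 5.1(a), p. 174 of the 2nd ed.: "`E` has good reduction if and only if `v(Δ) = 0`, i.e.
`Δ ∈ R^*`", for `E` given by a minimal Weierstrass equation. Mathlib's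
`WeierstrassCurve.HasGoodReduction` is *defined* by `v(Δ) = 1` (multiplicative notation) on a
minimal equation, and `W.HasGoodReductionAt v` applies it to the chosen local minimal model
`W.localMinimalModel v` over `O_v`, so the proof is the bookkeeping between the additive valuation
`IsDiscreteValuationRing.addVal` on `O_v` of the discriminant of the integral minimal model
`W.localMinimalIntegralModel v` and the `v`-adic valuation on `K_v` of the discriminant of
`W.localMinimalModel v` (`WeierstrassCurve.integralModel_Δ_eq`,
`IsDiscreteValuationRing.addVal_eq_zero_iff`,
`IsDedekindDomain.HeightOneSpectrum.valuation_eq_one_iff_notMem`,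
`IsLocalRing.notMem_maximalIdeal`); ellipticity of `W` (hence of the local minimal model, an
admissible change of variables of a base change of `W`) rules out the junk branch `Δ = 0`
(`addVal 0 = ⊤`, `⊤.toNat = 0`).
(Dot-notation extension of the Mathlib namespace `WeierstrassCurve`.)
[cite: SilvermanAEC2009, VII.5 Prop. 5.1(a)] -/
theorem ordMinimalDiscriminant_eq_zero_iff_holds (v : HeightOneSpectrum A)
    (W : WeierstrassCurve K) : ordMinimalDiscriminant_eq_zero_iff v W := by
  intro _
  haveI hM : (W.localMinimalModel v).IsElliptic := by
    unfold localMinimalModel minimal baseChange; infer_instance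
  have hΔ : (W.localMinimalIntegralModel v).Δ ≠ 0 := by
    intro h
    apply (W.localMinimalModel v).isUnit_Δ.ne_zero
    rw [← integralModel_Δ_eq (v.adicCompletionIntegers K) (W.localMinimalModel v)]
    change algebraMap _ _ (W.localMinimalIntegralModel v).Δ = 0
    rw [h, map_zero]
  unfold ordMinimalDiscriminant HasGoodReductionAt
  rw [ENat.toNat_eq_zero, IsDiscreteValuationRing.addVal_eq_zero_iff,
    IsDiscreteValuationRing.addVal_eq_top_iff, or_iff_left hΔ, hasGoodReduction_iff,
    and_iff_right (instIsMinimalLocalMinimalModel v W),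
    ← integralModel_Δ_eq (v.adicCompletionIntegers K) (W.localMinimalModel v),
    IsDedekindDomain.HeightOneSpectrum.valuation_eq_one_iff_notMem]
  change _ ↔ (W.localMinimalIntegralModel v).Δ ∉ IsLocalRing.maximalIdeal _
  exact (IsLocalRing.notMem_maximalIdeal).symm

end Local

end WeierstrassCurve
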